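import Mathlib.Analysis.Calculus.LineDeriv.IntegrationByParts
import Mathlib.Analysis.InnerProductSpace.PiL2
import Mathlib.Analysis.SpecialFunctions.ExpDeriv
import Mathlib.MeasureTheory.Measure.Haar.InnerProductSpace
import HarnessLib

/-!
# Weighted Poincaré inequalities for compactly supported functions
# (Chruściel–Delay 2003, Appendix C, Lemma C.1 and Prop. C.2, flat scalar case)

The first analytic brick of the weighted elliptic theory behind the local deformation theorem of
the vacuum constraints (`Literature.Geometry.Lorentzian.ChruscielDelay_localConstraintDeformation`,
core `(A)`): for `u ∈ C¹_c(E)` on a finite-dimensional real inner product space `E` with an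
orthonormal basis `b` (`∂ᵢ = D(·)(bᵢ)`, `|∇f|² = Σᵢ (∂ᵢf)²`, `Δf = Σᵢ ∂ᵢ∂ᵢ f`) and weights
`v, w ∈ C²(E)`,

* `integral_weight_mul_sq_le_integral_gradSq` — **Lemma C.1**: `∫ (Δw − |∇w|²) u² ≤ ∫ |∇u|²`
  (expand `0 ≤ ∫ |∇u + u∇w|²` and integrate `∫ 2u ∂ᵢu ∂ᵢw = ∫ ∂ᵢ(u²) ∂ᵢw = −∫ u² ∂ᵢ∂ᵢw` by parts);
* `integral_exp_weight_mul_sq_le_integral_exp_gradSq` — **Prop. C.2**: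
  `∫ e^{2v} (Δv + Δw + |∇v|² − |∇w|²) u² ≤ ∫ e^{2v} |∇u|²`
  (Lemma C.1 for `e^{v}u`, and `∫ e^{2v} 2u ∂ᵢu ∂ᵢv = −∫ u² ∂ᵢ(e^{2v}∂ᵢv)`).

In *loc. cit.* the weights are functions of the distance to `∂M`, smooth only near `supp u`;
since only their `2`-jets on `supp u` enter, the global `C²` hypothesis used here is recovered by
a cut-off. The tensor-field version follows by summing over components. Everything is proved;
no statements of `Prop` type are introduced.

## References

* P. T. Chruściel, E. Delay, Mém. Soc. Math. Fr. 94 (2003), Appendix C, Lemma C.1, Prop. C.2.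
  [ChruscielDelay2003]
-/

noncomputable section

open Set Function Filter MeasureTheory
open scoped Topology ContDiff

namespace Literature.Analysis.PDE

namespace WeightedPoincare

variable {E : Type*} [NormedAddCommGroup E] [InnerProductSpace ℝ E] {ι : Type*} [Fintype ι]

/-! ### Calculus of the integrands -/

/-- `∂ₑ(u²) = 2u ∂ₑu`. [folklore] -/
theorem fderiv_sq_apply {u : E → ℝ} {x : E} (hu : DifferentiableAt ℝ u x) (e : E) :
    fderiv ℝ (fun y ↦ u y ^ 2) x e = 2 * u x * fderiv ℝ u x e := by
  rw [show (fun y ↦ u y ^ 2) = fun y ↦ u y * u y from funext fun y ↦ sq (u y),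
    fderiv_fun_mul hu hu]
  simp only [_root_.add_apply, FunLike.coe_smul, Pi.smul_apply, smul_eq_mul]
  ring

/-- `∂ₑ(e^{v} u) = e^{v} (u ∂ₑv + ∂ₑu)`. [folklore] -/
theorem fderiv_exp_mul_apply {u v : E → ℝ} {x : E} (hu : DifferentiableAt ℝ u x)
    (hv : DifferentiableAt ℝ v x) (e : E) :
    fderiv ℝ (fun y ↦ Real.exp (v y) * u y) x e =
      Real.exp (v x) * (u x * fderiv ℝ v x e + fderiv ℝ u x e) := by
  rw [fderiv_fun_mul hv.exp hu, fderiv_exp hv]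
  simp only [_root_.add_apply, FunLike.coe_smul, Pi.smul_apply, smul_eq_mul]
  ring

/-- `∂ₑ(e^{2v} ∂ₑv) = e^{2v} (2 (∂ₑv)² + ∂ₑ∂ₑv)`. [folklore] -/
theorem fderiv_exp_two_mul_fderiv_apply {v : E → ℝ} (hv : ContDiff ℝ 2 v) (x e : E) :
    fderiv ℝ (fun y ↦ Real.exp (2 * v y) * fderiv ℝ v y e) x e =
      Real.exp (2 * v x) * (2 * fderiv ℝ v x e ^ 2 + fderiv ℝ (fun y ↦ fderiv ℝ v y e) x e) := by
  have hv1 : Differentiable ℝ v := hv.differentiable (by norm_num)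
  have hdv : Differentiable ℝ fun y ↦ fderiv ℝ v y e :=
    ((hv.fderiv_right (m := 1) (by norm_num)).clm_apply contDiff_const).differentiable one_ne_zero
  have h2v : DifferentiableAt ℝ (fun y ↦ 2 * v y) x := (hv1 x).const_mul 2
  rw [fderiv_fun_mul h2v.exp (hdv x), fderiv_exp h2v, fderiv_const_mul (hv1 x)]
  simp only [_root_.add_apply, FunLike.coe_smul, Pi.smul_apply, smul_eq_mul]
  ring

/-! ### Integration by parts of `∂ₑ(u²)` -/

variable [FiniteDimensional ℝ E] [MeasurableSpace E] [BorelSpace E]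

omit [InnerProductSpace ℝ E] [FiniteDimensional ℝ E] [MeasurableSpace E] [BorelSpace E] in
/-- `u²` has compact support when `u` has. [folklore] -/
theorem hasCompactSupport_sq {u : E → ℝ} (huc : HasCompactSupport u) :
    HasCompactSupport fun x ↦ u x ^ 2 := by
  have h := huc.mul_right (f' := u)
  have he : (fun x ↦ u x ^ 2) = u * u := funext fun x ↦ by simp [sq]
  rw [he]
  exact h

/-- **Integration by parts of `∂ₑ(u²)` against a `C¹` function `g`:**
`∫ 2u ∂ₑu · g = −∫ u² ∂ₑg`. [folklore] -/
theorem integral_two_mul_fderiv_mul_eq {u g : E → ℝ} (hu : ContDiff ℝ 1 u)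
    (huc : HasCompactSupport u) (hg : ContDiff ℝ 1 g) (e : E) :
    ∫ x, 2 * u x * fderiv ℝ u x e * g x = -∫ x, u x ^ 2 * fderiv ℝ g x e := by
  have hu0 : Continuous u := hu.continuous
  have hu1 : Differentiable ℝ u := hu.differentiable one_ne_zero
  have hdu : Continuous fun x ↦ fderiv ℝ u x e :=
    (hu.continuous_fderiv one_ne_zero).clm_apply continuous_const
  have hg0 : Continuous g := hg.continuous
  have hg1 : Differentiable ℝ g := hg.differentiable one_ne_zero
  have hdg : Continuous fun x ↦ fderiv ℝ g x e :=
    (hg.continuous_fderiv one_ne_zero).clm_apply continuous_const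
  have hsqc : HasCompactSupport fun x ↦ u x ^ 2 := hasCompactSupport_sq huc
  have hsq1 : Differentiable ℝ fun x ↦ u x ^ 2 := hu1.pow 2
  have hderiv : ∀ x, fderiv ℝ (fun y ↦ u y ^ 2) x e = 2 * u x * fderiv ℝ u x e := fun x ↦
    fderiv_sq_apply (hu1 x) e
  -- `∫ u² ∂ₑg = -∫ ∂ₑ(u²) g`
  have hibp := integral_mul_fderiv_eq_neg_fderiv_mul_of_integrable (μ := volume)
    (f := fun x ↦ u x ^ 2) (g := g) (v := e) ?_ ?_ ?_ (fun x _ ↦ hsq1 x) (fun x _ ↦ hg1 x)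
  · rw [hibp, neg_neg]
    refine integral_congr_ae (Eventually.of_forall fun x ↦ ?_)
    simp only [hderiv]
  · simp_rw [hderiv]
    exact (((continuous_const.mul hu0).mul hdu).mul hg0).integrable_of_hasCompactSupport
      ((huc.mul_left).mul_right.mul_right)
  · exact ((hu0.pow 2).mul hdg).integrable_of_hasCompactSupport hsqc.mul_right
  · exact ((hu0.pow 2).mul hg0).integrable_of_hasCompactSupport hsqc.mul_right

/-! ### Lemma C.1 -/

section Main

variable (b : OrthonormalBasis ι ℝ E)

/-- **Chruściel–Delay 2003, Lemma C.1** (flat scalar case): for `u ∈ C¹_c(E)` and `w ∈ C²(E)`,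
`∫ (Δw − |∇w|²) u² ≤ ∫ |∇u|²`. [cite: ChruscielDelay2003, Appendix C, Lemma C.1] -/
theorem integral_weight_mul_sq_le_integral_gradSq {u w : E → ℝ} (hu : ContDiff ℝ 1 u)
    (huc : HasCompactSupport u) (hw : ContDiff ℝ 2 w) :
    ∫ x, (∑ i, fderiv ℝ (fun y ↦ fderiv ℝ w y (b i)) x (b i) - ∑ i, fderiv ℝ w x (b i) ^ 2) *
        u x ^ 2 ≤ ∫ x, ∑ i, fderiv ℝ u x (b i) ^ 2 := by
  have hu0 : Continuous u := hu.continuous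
  have hu1 : Differentiable ℝ u := hu.differentiable one_ne_zero
  have hdu : ∀ i, Continuous fun x ↦ fderiv ℝ u x (b i) := fun i ↦
    (hu.continuous_fderiv one_ne_zero).clm_apply continuous_const
  have hw1 : ContDiff ℝ 1 w := hw.of_le (by norm_num)
  have hdw : ∀ i, Continuous fun x ↦ fderiv ℝ w x (b i) := fun i ↦
    (hw.continuous_fderiv (by norm_num)).clm_apply continuous_const
  have hdw1 : ∀ i, ContDiff ℝ 1 fun x ↦ fderiv ℝ w x (b i) := fun i ↦
    (hw.fderiv_right (m := 1) (by norm_num)).clm_apply contDiff_const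
  have hddw : ∀ i, Continuous fun x ↦ fderiv ℝ (fun y ↦ fderiv ℝ w y (b i)) x (b i) := fun i ↦
    ((hdw1 i).continuous_fderiv one_ne_zero).clm_apply continuous_const
  have hsqc : HasCompactSupport fun x ↦ u x ^ 2 := hasCompactSupport_sq huc
  have hduc : ∀ i, HasCompactSupport fun x ↦ fderiv ℝ u x (b i) := fun i ↦
    huc.fderiv_apply (𝕜 := ℝ) (b i)
  -- integrability of the four integrands
  have hAi : Integrable fun x ↦ ∑ i, fderiv ℝ u x (b i) ^ 2 := by
    refine integrable_finsetSum _ fun i _ ↦ ?_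
    have h : (fun x ↦ fderiv ℝ u x (b i) ^ 2) = fun x ↦ fderiv ℝ u x (b i) * fderiv ℝ u x (b i) :=
      funext fun x ↦ sq _
    rw [h]
    exact ((hdu i).mul (hdu i)).integrable_of_hasCompactSupport (hduc i).mul_right
  have hBi : Integrable fun x ↦ (∑ i, fderiv ℝ w x (b i) ^ 2) * u x ^ 2 :=
    ((continuous_finsetSum _ fun i _ ↦ (hdw i).pow 2).mul (hu0.pow 2)).integrable_of_hasCompactSupport
      hsqc.mul_left
  have hCi' : ∀ i, Integrable fun x ↦ 2 * u x * fderiv ℝ u x (b i) * fderiv ℝ w x (b i) := fun i ↦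
    (((continuous_const.mul hu0).mul (hdu i)).mul (hdw i)).integrable_of_hasCompactSupport
      ((huc.mul_left).mul_right.mul_right)
  have hCi : Integrable fun x ↦ ∑ i, 2 * u x * fderiv ℝ u x (b i) * fderiv ℝ w x (b i) :=
    integrable_finsetSum _ fun i _ ↦ hCi' i
  have hLi : Integrable fun x ↦ (∑ i, fderiv ℝ (fun y ↦ fderiv ℝ w y (b i)) x (b i)) * u x ^ 2 :=
    ((continuous_finsetSum _ fun i _ ↦ hddw i).mul (hu0.pow 2)).integrable_of_hasCompactSupport
      hsqc.mul_left
  -- the four integrands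
  set A : E → ℝ := fun x ↦ ∑ i, fderiv ℝ u x (b i) ^ 2 with hA
  set B : E → ℝ := fun x ↦ (∑ i, fderiv ℝ w x (b i) ^ 2) * u x ^ 2 with hB
  set Cx : E → ℝ := fun x ↦ ∑ i, 2 * u x * fderiv ℝ u x (b i) * fderiv ℝ w x (b i) with hCx
  set L : E → ℝ := fun x ↦ (∑ i, fderiv ℝ (fun y ↦ fderiv ℝ w y (b i)) x (b i)) * u x ^ 2 with hL
  -- the cross term integrates to `-∫ L`
  have hcross : ∫ x, Cx x = -∫ x, L x := by
    rw [hCx, integral_finsetSum _ fun i _ ↦ hCi' i]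
    have h : ∀ i, ∫ x, 2 * u x * fderiv ℝ u x (b i) * fderiv ℝ w x (b i) =
        -∫ x, u x ^ 2 * fderiv ℝ (fun y ↦ fderiv ℝ w y (b i)) x (b i) := fun i ↦
      integral_two_mul_fderiv_mul_eq hu huc (hdw1 i) (b i)
    simp_rw [h, Finset.sum_neg_distrib]
    rw [← integral_finsetSum _ fun i _ ↦ ?_]
    · congr 1
      refine integral_congr_ae (Eventually.of_forall fun x ↦ ?_)
      simp only [hL, Finset.sum_mul]
      exact Finset.sum_congr rfl fun i _ ↦ by ring
    · exact ((hu0.pow 2).mul (hddw i)).integrable_of_hasCompactSupport hsqc.mul_right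
  -- the pointwise square
  have hpt : ∀ x, ∑ i, (fderiv ℝ u x (b i) + u x * fderiv ℝ w x (b i)) ^ 2 = A x + B x + Cx x := by
    intro x
    simp only [hA, hB, hCx, Finset.sum_mul, ← Finset.sum_add_distrib]
    exact Finset.sum_congr rfl fun i _ ↦ by ring
  have hnonneg : 0 ≤ ∫ x, (A x + B x + Cx x) :=
    integral_nonneg fun x ↦ by
      rw [← hpt x]
      exact Finset.sum_nonneg fun i _ ↦ sq_nonneg _
  rw [integral_add (f := fun x ↦ A x + B x) (g := Cx) (hAi.add hBi) hCi, integral_add hAi hBi, hcross] at hnonneg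
  -- conclusion
  have hsplit : ∫ x, (∑ i, fderiv ℝ (fun y ↦ fderiv ℝ w y (b i)) x (b i) -
      ∑ i, fderiv ℝ w x (b i) ^ 2) * u x ^ 2 = (∫ x, L x) - ∫ x, B x := by
    rw [← integral_sub hLi hBi]
    refine integral_congr_ae (Eventually.of_forall fun x ↦ ?_)
    simp only [hL, hB]
    ring
  rw [hsplit]
  linarith

/-- **Chruściel–Delay 2003, Prop. C.2** (flat scalar case): for `u ∈ C¹_c(E)` and
`v, w ∈ C²(E)`, `∫ e^{2v} (Δv + Δw + |∇v|² − |∇w|²) u² ≤ ∫ e^{2v} |∇u|²`.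
[cite: ChruscielDelay2003, Appendix C, Prop. C.2] -/
theorem integral_exp_weight_mul_sq_le_integral_exp_gradSq {u v w : E → ℝ} (hu : ContDiff ℝ 1 u)
    (huc : HasCompactSupport u) (hv : ContDiff ℝ 2 v) (hw : ContDiff ℝ 2 w) :
    ∫ x, Real.exp (2 * v x) *
        ((∑ i, fderiv ℝ (fun y ↦ fderiv ℝ v y (b i)) x (b i)) +
          (∑ i, fderiv ℝ (fun y ↦ fderiv ℝ w y (b i)) x (b i)) +
          (∑ i, fderiv ℝ v x (b i) ^ 2) - ∑ i, fderiv ℝ w x (b i) ^ 2) * u x ^ 2 ≤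
      ∫ x, Real.exp (2 * v x) * ∑ i, fderiv ℝ u x (b i) ^ 2 := by
  -- apply Lemma C.1 to `U = e^{v} u`
  set U : E → ℝ := fun x ↦ Real.exp (v x) * u x with hU
  have hv1 : ContDiff ℝ 1 v := hv.of_le (by norm_num)
  have hU1 : ContDiff ℝ 1 U := (hv1.exp).mul hu
  have hUc : HasCompactSupport U := huc.mul_left
  have hC1 := integral_weight_mul_sq_le_integral_gradSq b hU1 hUc hw
  -- pointwise quantities
  have hu0 : Continuous u := hu.continuous
  have hu1 : Differentiable ℝ u := hu.differentiable one_ne_zero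
  have hvd : Differentiable ℝ v := hv.differentiable (by norm_num)
  have hev : Continuous fun x ↦ Real.exp (2 * v x) := (continuous_const.mul hv.continuous).rexp
  have hdu : ∀ i, Continuous fun x ↦ fderiv ℝ u x (b i) := fun i ↦
    (hu.continuous_fderiv one_ne_zero).clm_apply continuous_const
  have hdv : ∀ i, Continuous fun x ↦ fderiv ℝ v x (b i) := fun i ↦
    (hv.continuous_fderiv (by norm_num)).clm_apply continuous_const
  have hdv1 : ∀ i, ContDiff ℝ 1 fun x ↦ fderiv ℝ v x (b i) := fun i ↦
    (hv.fderiv_right (m := 1) (by norm_num)).clm_apply contDiff_const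
  have hddv : ∀ i, Continuous fun x ↦ fderiv ℝ (fun y ↦ fderiv ℝ v y (b i)) x (b i) := fun i ↦
    ((hdv1 i).continuous_fderiv one_ne_zero).clm_apply continuous_const
  have hdw : ∀ i, Continuous fun x ↦ fderiv ℝ w x (b i) := fun i ↦
    (hw.continuous_fderiv (by norm_num)).clm_apply continuous_const
  have hdw1 : ∀ i, ContDiff ℝ 1 fun x ↦ fderiv ℝ w x (b i) := fun i ↦
    (hw.fderiv_right (m := 1) (by norm_num)).clm_apply contDiff_const
  have hddw : ∀ i, Continuous fun x ↦ fderiv ℝ (fun y ↦ fderiv ℝ w y (b i)) x (b i) := fun i ↦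
    ((hdw1 i).continuous_fderiv one_ne_zero).clm_apply continuous_const
  have hsqc : HasCompactSupport fun x ↦ u x ^ 2 := hasCompactSupport_sq huc
  have hexp2 : ∀ x, Real.exp (v x) ^ 2 = Real.exp (2 * v x) := fun x ↦ by
    rw [← Real.exp_nat_mul]; norm_num
  -- `|∇U|² = e^{2v} (|∇u|² + |∇v|² u² + Σ 2 u ∂ᵢu ∂ᵢv)`
  have hdU : ∀ x i, fderiv ℝ U x (b i) = Real.exp (v x) * (u x * fderiv ℝ v x (b i) + fderiv ℝ u x (b i)) :=
    fun x i ↦ fderiv_exp_mul_apply (hu1 x) (hvd x) (b i)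
  set A : E → ℝ := fun x ↦ Real.exp (2 * v x) * ∑ i, fderiv ℝ u x (b i) ^ 2 with hA
  set B : E → ℝ := fun x ↦ Real.exp (2 * v x) * (∑ i, fderiv ℝ v x (b i) ^ 2) * u x ^ 2 with hB
  set Cx : E → ℝ := fun x ↦ ∑ i, 2 * u x * fderiv ℝ u x (b i) * (Real.exp (2 * v x) * fderiv ℝ v x (b i))
    with hCx
  set L : E → ℝ := fun x ↦ u x ^ 2 * (Real.exp (2 * v x) *
      ∑ i, (2 * fderiv ℝ v x (b i) ^ 2 + fderiv ℝ (fun y ↦ fderiv ℝ v y (b i)) x (b i))) with hL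
  have hgradU : ∀ x, ∑ i, fderiv ℝ U x (b i) ^ 2 = A x + B x + Cx x := by
    intro x
    simp only [hdU, hA, hB, hCx, Finset.mul_sum, Finset.sum_mul, ← Finset.sum_add_distrib, ← hexp2]
    exact Finset.sum_congr rfl fun i _ ↦ by ring
  -- integrability
  have hcs_u : ∀ {F : E → ℝ}, Continuous F → Integrable fun x ↦ u x * F x := fun hF ↦
    (hu0.mul hF).integrable_of_hasCompactSupport huc.mul_right
  have hcs_u2 : ∀ {F : E → ℝ}, Continuous F → Integrable fun x ↦ u x ^ 2 * F x := fun hF ↦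
    ((hu0.pow 2).mul hF).integrable_of_hasCompactSupport hsqc.mul_right
  have hcs_du : ∀ (i) {F : E → ℝ}, Continuous F → Integrable fun x ↦ fderiv ℝ u x (b i) * F x :=
    fun i F hF ↦ ((hdu i).mul hF).integrable_of_hasCompactSupport
      ((huc.fderiv_apply (𝕜 := ℝ) (b i)).mul_right)
  have hAi : Integrable A := by
    have h : A = fun x ↦ ∑ i, fderiv ℝ u x (b i) * (fderiv ℝ u x (b i) * Real.exp (2 * v x)) := by
      funext x; simp only [hA, Finset.mul_sum]; exact Finset.sum_congr rfl fun i _ ↦ by ring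
    rw [h]
    exact integrable_finsetSum _ fun i _ ↦ hcs_du i ((hdu i).mul hev)
  have hBi : Integrable B := by
    have h : B = fun x ↦ u x ^ 2 * (Real.exp (2 * v x) * ∑ i, fderiv ℝ v x (b i) ^ 2) := by
      funext x; simp only [hB]; ring
    rw [h]
    exact hcs_u2 (hev.mul (continuous_finsetSum _ fun i _ ↦ (hdv i).pow 2))
  have hCi' : ∀ i, Integrable fun x ↦
      2 * u x * fderiv ℝ u x (b i) * (Real.exp (2 * v x) * fderiv ℝ v x (b i)) := fun i ↦ by
    have h : (fun x ↦ 2 * u x * fderiv ℝ u x (b i) * (Real.exp (2 * v x) * fderiv ℝ v x (b i))) =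
        fun x ↦ u x * (2 * fderiv ℝ u x (b i) * (Real.exp (2 * v x) * fderiv ℝ v x (b i))) := by
      funext x; ring
    rw [h]
    exact hcs_u ((continuous_const.mul (hdu i)).mul (hev.mul (hdv i)))
  have hCi : Integrable Cx := integrable_finsetSum _ fun i _ ↦ hCi' i
  have hLi : Integrable L :=
    hcs_u2 (hev.mul (continuous_finsetSum _ fun i _ ↦
      (continuous_const.mul ((hdv i).pow 2)).add (hddv i)))
  -- the cross term: `∫ C = -∫ L`
  have hg1 : ∀ i, ContDiff ℝ 1 fun x ↦ Real.exp (2 * v x) * fderiv ℝ v x (b i) := fun i ↦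
    ((contDiff_const.mul hv1).exp).mul (hdv1 i)
  have hcross : ∫ x, Cx x = -∫ x, L x := by
    rw [hCx, integral_finsetSum _ fun i _ ↦ hCi' i]
    have h : ∀ i, ∫ x, 2 * u x * fderiv ℝ u x (b i) * (Real.exp (2 * v x) * fderiv ℝ v x (b i)) =
        -∫ x, u x ^ 2 * (Real.exp (2 * v x) *
          (2 * fderiv ℝ v x (b i) ^ 2 + fderiv ℝ (fun y ↦ fderiv ℝ v y (b i)) x (b i))) := by
      intro i
      rw [integral_two_mul_fderiv_mul_eq hu huc (hg1 i) (b i)]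
      congr 1
      refine integral_congr_ae (Eventually.of_forall fun x ↦ ?_)
      simp only [fderiv_exp_two_mul_fderiv_apply hv x (b i)]
    simp_rw [h, Finset.sum_neg_distrib]
    rw [← integral_finsetSum _ fun i _ ↦ ?_]
    · congr 1
      refine integral_congr_ae (Eventually.of_forall fun x ↦ ?_)
      simp only [hL, Finset.mul_sum]
    · exact hcs_u2 (hev.mul ((continuous_const.mul ((hdv i).pow 2)).add (hddv i)))
  -- `∫ |∇U|² = ∫ A + ∫ B - ∫ L`
  have hgrad : ∫ x, ∑ i, fderiv ℝ U x (b i) ^ 2 = (∫ x, A x) + (∫ x, B x) - ∫ x, L x := by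
    rw [integral_congr_ae (Eventually.of_forall hgradU : (fun x ↦ ∑ i, fderiv ℝ U x (b i) ^ 2) =ᵐ[volume]
      fun x ↦ A x + B x + Cx x), integral_add (f := fun x ↦ A x + B x) (g := Cx) (hAi.add hBi) hCi,
      integral_add hAi hBi, hcross]
    ring
  -- the weight side of Lemma C.1 for `U`
  set IW : ℝ := ∫ x, Real.exp (2 * v x) *
    ((∑ i, fderiv ℝ (fun y ↦ fderiv ℝ w y (b i)) x (b i)) - ∑ i, fderiv ℝ w x (b i) ^ 2) * u x ^ 2
    with hIW
  have hWi : Integrable fun x ↦ Real.exp (2 * v x) *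
      ((∑ i, fderiv ℝ (fun y ↦ fderiv ℝ w y (b i)) x (b i)) - ∑ i, fderiv ℝ w x (b i) ^ 2) *
        u x ^ 2 := by
    have h : (fun x ↦ Real.exp (2 * v x) *
        ((∑ i, fderiv ℝ (fun y ↦ fderiv ℝ w y (b i)) x (b i)) - ∑ i, fderiv ℝ w x (b i) ^ 2) *
        u x ^ 2) = fun x ↦ u x ^ 2 * (Real.exp (2 * v x) *
        ((∑ i, fderiv ℝ (fun y ↦ fderiv ℝ w y (b i)) x (b i)) - ∑ i, fderiv ℝ w x (b i) ^ 2)) := by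
      funext x; ring
    rw [h]
    exact hcs_u2 (hev.mul ((continuous_finsetSum _ fun i _ ↦ hddw i).sub
      (continuous_finsetSum _ fun i _ ↦ (hdw i).pow 2)))
  have hWU : ∫ x, ((∑ i, fderiv ℝ (fun y ↦ fderiv ℝ w y (b i)) x (b i)) -
      ∑ i, fderiv ℝ w x (b i) ^ 2) * U x ^ 2 = IW := by
    rw [hIW]
    refine integral_congr_ae (Eventually.of_forall fun x ↦ ?_)
    simp only [hU, mul_pow, hexp2]
    ring
  -- the left-hand side of the claim
  have hLHS : ∫ x, Real.exp (2 * v x) *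
      ((∑ i, fderiv ℝ (fun y ↦ fderiv ℝ v y (b i)) x (b i)) +
        (∑ i, fderiv ℝ (fun y ↦ fderiv ℝ w y (b i)) x (b i)) +
        (∑ i, fderiv ℝ v x (b i) ^ 2) - ∑ i, fderiv ℝ w x (b i) ^ 2) * u x ^ 2 =
      IW + (∫ x, L x) - ∫ x, B x := by
    rw [hIW, ← integral_add hWi hLi, ← integral_sub (f := fun x ↦ Real.exp (2 * v x) *
      ((∑ i, fderiv ℝ (fun y ↦ fderiv ℝ w y (b i)) x (b i)) - ∑ i, fderiv ℝ w x (b i) ^ 2) *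
        u x ^ 2 + L x) (g := B) (hWi.add hLi) hBi]
    refine integral_congr_ae (Eventually.of_forall fun x ↦ ?_)
    simp only [hL, hB, Finset.sum_add_distrib, ← Finset.mul_sum]
    ring
  rw [hWU, hgrad] at hC1
  rw [hLHS]
  linarith

end Main

end WeightedPoincare

end Literature.Analysis.PDE

end
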